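import Summits.ABC.ABC.Theses.IneffectiveSubspace
import Summits.ABC.ABC.Theorems.IneffectiveSubspaceAbcGivesUniformSadic
import Summits.ABC.ABC.Theorems.IneffectiveSubspaceUniformSadicGivesTowerFour

/-!
# Fourth-power divisors of `x² − 1`: the simplest necessary core of `UniformSadicTowerFour` (stmt-ABC-14937)

Calibration lemmas of line `SketchIdeator5` (crux-ideate round 2, ideator 5: the "Pell skeleton" of the
`K = 0` face; `Cruxes/UniformSadicTowerFour/StructureNotes-r2-k5.md` §1, §5) for crux #2 of route
`IneffectiveSubspace`, re-derived and kernel-checked by the line lead.  Write `T(n)` for the largest `t`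
with `t⁴ ∣ n` and

  `ConjP := ∀ ε > 0, ∃ C, ∀ x ≥ 2, ∀ t, t⁴ ∣ x² − 1 → t ≤ C · x^(1/3 + ε)`

(inlined everywhere below; no auxiliary `def`).  Contents:

* `conjP_of_towerIneqFourOne` — **Vojta exponent `1` on `X_4` (the crux's `K = 0` face) implies `ConjP`**:
  the level-4 tower point `x = (1,1,1,1)`, `y = (m,1,1,t)`, `z = (1,x,1,1)` of the triple
  `1 + (x² − 1) = x²` (`x² − 1 = m·t⁴`) gives `x² < C·(m·x·t)^(1+ε)`, and `m·x·t·t³ = (x² − 1)·x < x³`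
  gives `x²·t^(3(1+ε)) < C·x^(3(1+ε))`, whence `t ≤ max C 1 · x^(1/3+ε)`.
* `conjP_of_uniformSadicTowerFour` — hence **the crux implies `ConjP`** (`K = 0`, `S = ∅`: the bracket of
  `M ≠ 0` is `M`, `UniformSadicGivesTowerFour.bracket_empty`), and `conjP_of_abc` — `ABC ⟹ ConjP`
  (through the landed `abcGivesUniformSadic_proof`).  So `ConjP` is a common consequence of every
  statement in the sandwich `ABC ⟹ crux ⟹ TowerIneqAt 4 1`; its exponent `1/2` is trivial
  (`fourthPowerDivisor_sq_lt`: `t⁴ ∣ x² − 1`, `x ≥ 2` ⟹ `t² < x`) and nothing below `1/2` is known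
  (StructureNotes-r2-k5 §5: a saving below `1/2` is a polynomial height bound for the binomial quartic
  Thue family `m₂t₂⁴ − m₁t₁⁴ ∈ {1, 2}`).
* `fourthPowerDivisor_primePow_le` — prime powers are not the enemy: for an odd prime `p`,
  `p^(4k) ∣ x² − 1`, `x ≥ 2` ⟹ `p^(4k) ≤ x + 1` (exponent `1/4`); the content of `ConjP` is in the coprime
  splittings `x ∓ 1 = m₁t₁⁴`, `x ± 1 = m₂t₂⁴` (StructureNotes-r2-k5 §5(e),(f)).
* `pell_norm_identity` — the algebraic identity behind the Pell skeleton: from `a + b = c`, `b·v = Y⁴`,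
  `c·w = Z⁴` one gets `v·Z⁴ = w·Y⁴ + v·w·a`, i.e. `β := vZ² + Y²√(vw)` has norm `v²wa`
  (StructureNotes-r2-k5 §1).
* `pellSquareClassSmall_of_conjP` — `ConjP` gives "floor rigidity" on Ljunggren's family: solutions of
  `x² = 4dt⁴ + 1` (`d, t ≥ 1`) have `x ≤ C_ε · d^(3/2+ε)` (StructureNotes-r2-k5 §1, §5(d)).

What is NOT here: no composition concluding the crux — the line is a necessary-condition map (its own
notes, §7(3): "no line should be built from the Pell skeleton alone"); see `Lines/SketchIdeator5.dead.md`
in the crux directory.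

Sources: P. Vojta, *Diophantine approximations and value distribution theory*, LNM 1239 (1987)
[Vojta1987] (the `S`-version of the Main Conjecture; context only).  Uses only Mathlib and the landed
`UniformSadicGivesTowerFour.bracket_empty`, `abcGivesUniformSadic_proof`.
-/

-- `Summit.<Summit>.<Problem>` is the mandated summit-side namespace (CONVENTIONS §2); for the
-- single-conjunct summit `ABC` the two coincide, so the duplicate `ABC.ABC` is deliberate.
set_option linter.dupNamespace false

namespace Summit.ABC.ABC.Theorems.UniformSadicTowerFour.FourthPowerDivisor

open scoped BigOperators
open Summit.ABC.ABC.Theses.IneffectiveSubspace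
open Summit.ABC.ABC.Theorems

/-- **The trivial exponent `1/2`.** If `2 ≤ x` and `t⁴ ∣ x² − 1` then `t² < x`
(`t⁴ ≤ x² − 1 < x²`; the hypothesis `2 ≤ x` keeps `x² − 1` positive, so the `ℕ`-subtraction is honest).
[folklore] -/
theorem fourthPowerDivisor_sq_lt {x t : ℕ} (hx : 2 ≤ x) (hdvd : t ^ 4 ∣ x ^ 2 - 1) : t ^ 2 < x := by
  have hx2 : 1 < x ^ 2 := by nlinarith
  have hpos : 0 < x ^ 2 - 1 := Nat.sub_pos_of_lt hx2
  have hlt : x ^ 2 - 1 < x ^ 2 := Nat.sub_lt (by omega) one_pos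
  have hle : t ^ 4 ≤ x ^ 2 - 1 := Nat.le_of_dvd hpos hdvd
  have h4 : (t ^ 2) ^ 2 < x ^ 2 := by
    have : t ^ 4 < x ^ 2 := lt_of_le_of_lt hle hlt
    simpa [← pow_mul] using this
  exact (Nat.pow_lt_pow_iff_left (by norm_num)).mp h4

/-- **The real-variable step.** From `x² · (t³)^(1+ε) < C · (x³)^(1+ε)` with `x ≥ 1`, `C > 0`,
`ε > 0` it follows that `t ≤ max C 1 · x^(1/3 + ε)`: otherwise `t³ > (max C 1)³ · x^(1+3ε)` and
`x² · (t³)^(1+ε) > (max C 1)^(3(1+ε)) · x^(2 + (1+3ε)(1+ε)) ≥ C · x^(3(1+ε))`, since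
`2 + (1+3ε)(1+ε) − 3(1+ε) = ε + 3ε² ≥ 0`. [folklore] -/
theorem le_of_sq_mul_cube_rpow_lt {X T C ε : ℝ} (hX : 1 ≤ X) (hC : 0 < C) (hε : 0 < ε)
    (h : X ^ 2 * (T ^ 3) ^ (1 + ε) < C * (X ^ 3) ^ (1 + ε)) :
    T ≤ max C 1 * X ^ ((1 : ℝ) / 3 + ε) := by
  have hX0 : 0 < X := lt_of_lt_of_le one_pos hX
  have hε1 : 0 < 1 + ε := by linarith
  have hC'1 : (1 : ℝ) ≤ max C 1 := le_max_right _ _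
  have hC'0 : (0 : ℝ) < max C 1 := lt_of_lt_of_le one_pos hC'1
  by_contra hcon
  push Not at hcon
  have hs0 : 0 ≤ max C 1 * X ^ ((1 : ℝ) / 3 + ε) := by positivity
  -- cube both sides
  have hcube : (max C 1 * X ^ ((1 : ℝ) / 3 + ε)) ^ 3 < T ^ 3 := by gcongr
  have hcube' : (max C 1 * X ^ ((1 : ℝ) / 3 + ε)) ^ 3 = (max C 1) ^ 3 * X ^ (1 + 3 * ε) := by
    rw [mul_pow, ← Real.rpow_mul_natCast hX0.le]
    congr 2
    push_cast
    ring
  rw [hcube'] at hcube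
  -- raise to the power `1 + ε`
  have hD : ((max C 1) ^ 3 * X ^ (1 + 3 * ε)) ^ (1 + ε) < (T ^ 3) ^ (1 + ε) :=
    Real.rpow_lt_rpow (by positivity) hcube hε1
  rw [Real.mul_rpow (by positivity) (by positivity), ← Real.rpow_mul hX0.le] at hD
  -- lower bounds for the two factors
  have hCC : C ≤ ((max C 1) ^ 3) ^ (1 + ε) := by
    have h3 : (1 : ℝ) ≤ (max C 1) ^ 3 := one_le_pow₀ hC'1
    calc C ≤ max C 1 := le_max_left _ _
      _ ≤ (max C 1) ^ 3 := le_self_pow₀ hC'1 (by norm_num)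
      _ ≤ ((max C 1) ^ 3) ^ (1 + ε) := Real.self_le_rpow_of_one_le h3 (by linarith)
  have hXX : (X ^ 3) ^ (1 + ε) ≤ X ^ 2 * X ^ ((1 + 3 * ε) * (1 + ε)) := by
    rw [← Real.rpow_natCast_mul hX0.le, ← Real.rpow_two, ← Real.rpow_add hX0]
    refine Real.rpow_le_rpow_of_exponent_le hX ?_
    push_cast
    nlinarith [sq_nonneg ε]
  have hE : C * (X ^ 3) ^ (1 + ε) ≤ X ^ 2 * (T ^ 3) ^ (1 + ε) :=
    calc C * (X ^ 3) ^ (1 + ε)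
        ≤ ((max C 1) ^ 3) ^ (1 + ε) * (X ^ 2 * X ^ ((1 + 3 * ε) * (1 + ε))) :=
          mul_le_mul hCC hXX (by positivity) (by positivity)
      _ = X ^ 2 * (((max C 1) ^ 3) ^ (1 + ε) * X ^ ((1 + 3 * ε) * (1 + ε))) := by ring
      _ ≤ X ^ 2 * (T ^ 3) ^ (1 + ε) := mul_le_mul_of_nonneg_left hD.le (by positivity)
  exact absurd h (not_lt.mpr hE)

/-- **Vojta exponent `1` on `X_4` implies `ConjP`.** If for every `ε > 0` there is `C` with
`∏ zᵢ^(i+1) < C · (∏ xᵢyᵢzᵢ)^(1+ε)` for every positive coprime level-4 tower point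
`x₁x₂²x₃³x₄⁴ + y₁y₂²y₃³y₄⁴ = z₁z₂²z₃³z₄⁴` (the `K = 0` face of the crux, `TowerIneqAt 4 1`), then for every
`ε > 0` there is `C` with `t ≤ C · x^(1/3 + ε)` whenever `x ≥ 2` and `t⁴ ∣ x² − 1`.  Proof: the tower point
`x = (1,1,1,1)`, `y = (m,1,1,t)`, `z = (1,x,1,1)` of `1 + (x² − 1) = x²`, `x² − 1 = m·t⁴`, has
`∏ xᵢyᵢzᵢ = m·x·t` and `m·x·t·t³ = (x² − 1)·x < x³`; conclude with `le_of_sq_mul_cube_rpow_lt`.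
(StructureNotes-r2-k5 §5(b).) [folklore] -/
theorem conjP_of_towerIneqFourOne
    (hT : ∀ ε : ℝ, 0 < ε → ∃ C : ℝ, 0 < C ∧ ∀ x y z : Fin 4 → ℕ, (∀ i, 0 < x i ∧ 0 < y i ∧ 0 < z i) →
      (∏ i, x i ^ (i.val + 1)) + (∏ i, y i ^ (i.val + 1)) = ∏ i, z i ^ (i.val + 1) →
      Nat.Coprime (∏ i, x i ^ (i.val + 1)) (∏ i, y i ^ (i.val + 1)) →
      ((∏ i, z i ^ (i.val + 1) : ℕ) : ℝ) < C * ((∏ i, x i * y i * z i : ℕ) : ℝ) ^ (1 + ε)) :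
    ∀ ε : ℝ, 0 < ε → ∃ C : ℝ, 0 < C ∧ ∀ x t : ℕ, 2 ≤ x → t ^ 4 ∣ x ^ 2 - 1 →
      (t : ℝ) ≤ C * (x : ℝ) ^ ((1 : ℝ) / 3 + ε) := by
  intro ε hε
  obtain ⟨C, hC, hTow⟩ := hT ε hε
  refine ⟨max C 1, lt_of_lt_of_le one_pos (le_max_right _ _), fun x t hx hdvd => ?_⟩
  have hx1 : (1 : ℝ) ≤ x := by exact_mod_cast (show 1 ≤ x by omega)
  -- `t = 0` is trivial
  rcases Nat.eq_zero_or_pos t with rfl | ht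
  · simp only [Nat.cast_zero]; positivity
  -- `x² − 1 = t⁴ · m` with `m > 0`
  obtain ⟨m, hm⟩ := hdvd
  have hx0 : 0 < x := by omega
  have hx2 : 1 < x ^ 2 := by nlinarith
  have hsum : x ^ 2 = t ^ 4 * m + 1 := (Nat.sub_eq_iff_eq_add hx2.le).mp hm
  have hm0 : 0 < m := by
    rcases Nat.eq_zero_or_pos m with rfl | hm0
    · rw [mul_zero, zero_add] at hsum; nlinarith
    · exact hm0
  -- the tower point `x = (1,1,1,1)`, `y = (m,1,1,t)`, `z = (1,x,1,1)`
  have hsum' : 1 + m * t ^ 4 = x ^ 2 := by rw [hsum]; ring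
  have key := hTow ![1, 1, 1, 1] ![m, 1, 1, t] ![1, x, 1, 1]
    (by intro i; fin_cases i <;> simp [hm0, ht, hx0]) (by simpa [Fin.prod_univ_four] using hsum')
    (by simp [Fin.prod_univ_four])
  have h1 : (∏ i : Fin 4, (![1, x, 1, 1] : Fin 4 → ℕ) i ^ (i.val + 1)) = x ^ 2 := by
    simp [Fin.prod_univ_four]
  have h2 : (∏ i : Fin 4, (![1, 1, 1, 1] : Fin 4 → ℕ) i * (![m, 1, 1, t] : Fin 4 → ℕ) i *
      (![1, x, 1, 1] : Fin 4 → ℕ) i) = m * x * t := by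
    simp [Fin.prod_univ_four]
  rw [h1, h2] at key
  push_cast at key
  -- `m·x·t·t³ = (x² − 1)·x < x³`
  have hA : m * x * t * t ^ 3 < x ^ 3 := by
    have h3 : x ^ 3 = m * x * t * t ^ 3 + x := by rw [pow_succ, hsum]; ring
    rw [h3]
    exact Nat.lt_add_of_pos_right hx0
  have hA' : ((m : ℝ) * x * t) * (t : ℝ) ^ 3 < (x : ℝ) ^ 3 := by exact_mod_cast hA
  have hε1 : 0 < 1 + ε := by linarith
  have hB : (((m : ℝ) * x * t) * (t : ℝ) ^ 3) ^ (1 + ε) < ((x : ℝ) ^ 3) ^ (1 + ε) :=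
    Real.rpow_lt_rpow (by positivity) hA' hε1
  rw [Real.mul_rpow (by positivity) (by positivity)] at hB
  have hP : (0 : ℝ) < ((t : ℝ) ^ 3) ^ (1 + ε) := by positivity
  have hC1 : (x : ℝ) ^ 2 * ((t : ℝ) ^ 3) ^ (1 + ε) < C * ((x : ℝ) ^ 3) ^ (1 + ε) :=
    calc (x : ℝ) ^ 2 * ((t : ℝ) ^ 3) ^ (1 + ε)
        < C * ((m : ℝ) * x * t) ^ (1 + ε) * ((t : ℝ) ^ 3) ^ (1 + ε) := mul_lt_mul_of_pos_right key hP
      _ = C * (((m : ℝ) * x * t) ^ (1 + ε) * ((t : ℝ) ^ 3) ^ (1 + ε)) := by ring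
      _ < C * ((x : ℝ) ^ 3) ^ (1 + ε) := mul_lt_mul_of_pos_left hB hC
  exact le_of_sq_mul_cube_rpow_lt hx1 hC hε hC1

/-- **The crux implies `ConjP`**: `UniformSadicTowerFour` at `K = 0`, `S = ∅` is Vojta exponent `1` on
`X_4` (the bracket of `M ≠ 0` at `S = ∅` is `M` itself), so `conjP_of_towerIneqFourOne` applies.  This is the
crux's simplest necessary core (StructureNotes-r2-k5 §5): fourth-power divisors `t⁴ ∣ x² − 1` have
`t ≪_ε x^(1/3+ε)`. [folklore] -/
theorem conjP_of_uniformSadicTowerFour (hU : UniformSadicTowerFour) :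
    ∀ ε : ℝ, 0 < ε → ∃ C : ℝ, 0 < C ∧ ∀ x t : ℕ, 2 ≤ x → t ^ 4 ∣ x ^ 2 - 1 →
      (t : ℝ) ≤ C * (x : ℝ) ^ ((1 : ℝ) / 3 + ε) := by
  refine conjP_of_towerIneqFourOne fun ε hε => ?_
  obtain ⟨C, hC, hK⟩ := hU 0 ε hε
  refine ⟨C, hC, fun x y z hpos hsum hcop => ?_⟩
  have hM : (∏ i, x i * y i * z i) ≠ 0 :=
    (Finset.prod_pos fun i _ =>
      Nat.mul_pos (Nat.mul_pos (hpos i).1 (hpos i).2.1) (hpos i).2.2).ne'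
  have key := hK ∅ (by simp) (by simp) x y z hpos hsum hcop
  rwa [UniformSadicGivesTowerFour.bracket_empty hM] at key

/-- **`ABC ⟹ ConjP`** (through the landed `abcGivesUniformSadic_proof : ABC → UniformSadicTowerFour`):
fourth-power divisors `t⁴ ∣ x² − 1` have `t ≪_ε x^(1/3+ε)` under the abc conjecture. [folklore] -/
theorem conjP_of_abc (habc : ABC) :
    ∀ ε : ℝ, 0 < ε → ∃ C : ℝ, 0 < C ∧ ∀ x t : ℕ, 2 ≤ x → t ^ 4 ∣ x ^ 2 - 1 →
      (t : ℝ) ≤ C * (x : ℝ) ^ ((1 : ℝ) / 3 + ε) :=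
  conjP_of_uniformSadicTowerFour (abcGivesUniformSadic_proof habc)

/-- **The Pell norm identity of the level-4 face** (StructureNotes-r2-k5 §1): if `a + b = c`,
`b·v = Y⁴` and `c·w = Z⁴` (lifts of `b`, `c` to fourth powers), then `v·Z⁴ = w·Y⁴ + v·w·a`; i.e.
`β := vZ² + Y²√(vw) ∈ ℤ[√(vw)]` has norm `v²Z⁴ − vwY⁴ = v²wa`. [folklore] -/
theorem pell_norm_identity {a b c v w Y Z : ℕ} (habc : a + b = c) (hY : b * v = Y ^ 4)
    (hZ : c * w = Z ^ 4) : v * Z ^ 4 = w * Y ^ 4 + v * w * a := by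
  rw [← hZ, ← hY, ← habc]
  ring

/-- **Prime powers are not the enemy (exponent `1/4`).** If `p` is an odd prime, `2 ≤ x` and
`p^(4k) ∣ x² − 1`, then `p^(4k) ≤ x + 1`: `p` divides at most one of `x − 1`, `x + 1` (their difference is
`2`), so `p^(4k)` divides one of them.  Hence `T(x² − 1) ≤ (x+1)^(1/4)` on prime-power `t`; the content of
`ConjP` is in the coprime splittings `x ∓ 1 = m₁t₁⁴`, `x ± 1 = m₂t₂⁴` (StructureNotes-r2-k5 §5(e),(f)).
[folklore] -/
theorem fourthPowerDivisor_primePow_le {x p k : ℕ} (hp : p.Prime) (hp2 : p ≠ 2) (hx : 2 ≤ x)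
    (hdvd : p ^ (4 * k) ∣ x ^ 2 - 1) : p ^ (4 * k) ≤ x + 1 := by
  have hfac : x ^ 2 - 1 = (x + 1) * (x - 1) := by
    rw [show x ^ 2 - 1 = x ^ 2 - 1 ^ 2 by rw [one_pow], Nat.sq_sub_sq]
  rw [hfac] at hdvd
  -- `p` does not divide both factors
  have hnot : ¬ (p ∣ x + 1 ∧ p ∣ x - 1) := by
    rintro ⟨h1, h2⟩
    have h3 : p ∣ (x + 1) - (x - 1) := Nat.dvd_sub h1 h2
    rw [show (x + 1) - (x - 1) = 2 by omega] at h3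
    have := (Nat.prime_dvd_prime_iff_eq hp Nat.prime_two).mp h3
    exact hp2 this
  by_cases h1 : p ∣ x + 1
  · have h2 : ¬ p ∣ x - 1 := fun h2 => hnot ⟨h1, h2⟩
    have hcop : Nat.Coprime (p ^ (4 * k)) (x - 1) :=
      Nat.Coprime.pow_left _ ((Nat.Prime.coprime_iff_not_dvd hp).mpr h2)
    exact Nat.le_of_dvd (Nat.succ_pos _) (hcop.dvd_of_dvd_mul_right hdvd)
  · have hcop : Nat.Coprime (p ^ (4 * k)) (x + 1) :=
      Nat.Coprime.pow_left _ ((Nat.Prime.coprime_iff_not_dvd hp).mpr h1)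
    have hd : p ^ (4 * k) ∣ x - 1 := hcop.dvd_of_dvd_mul_left hdvd
    exact (Nat.le_of_dvd (by omega) hd).trans (by omega)

/-- **`ConjP` gives floor rigidity on Ljunggren's family** (StructureNotes-r2-k5 §1, §5(d)): if fourth-power
divisors `t⁴ ∣ x² − 1` satisfy `t ≤ C_ε · x^(1/3+ε)`, then every solution of `x² = 4·d·t⁴ + 1` with
`d, t ≥ 1` has `x ≤ C'_ε · d^(3/2+ε)` — the unit `x + 2t²√d` of `ℤ[√d]` with a square `√d`-coordinate class
sits within `O(1)` of the floor of its size range.  Proof: `t⁴ ∣ x² − 1`, so `t ≤ C·x^(1/3+ε')` and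
`x² ≤ 4dC⁴x^(4/3+4ε') + 1 ≤ 5·max(C,1)⁴·d·x^(4/3+4ε')`, i.e. `x^(2/3−4ε') ≤ 5·max(C,1)⁴·d`, with
`ε' = min ε 1 / 15`. [folklore] -/
theorem pellSquareClassSmall_of_conjP
    (hP : ∀ ε : ℝ, 0 < ε → ∃ C : ℝ, 0 < C ∧ ∀ x t : ℕ, 2 ≤ x → t ^ 4 ∣ x ^ 2 - 1 →
      (t : ℝ) ≤ C * (x : ℝ) ^ ((1 : ℝ) / 3 + ε)) :
    ∀ ε : ℝ, 0 < ε → ∃ C : ℝ, 0 < C ∧ ∀ x d t : ℕ, 0 < d → 0 < t → x ^ 2 = 4 * d * t ^ 4 + 1 →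
      (x : ℝ) ≤ C * (d : ℝ) ^ ((3 : ℝ) / 2 + ε) := by
  intro ε hε
  -- the auxiliary exponent
  set ε' : ℝ := min ε 1 / 15 with hε'def
  have hε'0 : 0 < ε' := by have := lt_min hε one_pos; positivity
  have hε'ε : ε' * (9 + 6 * ε) ≤ ε := by
    rcases le_or_gt ε 1 with h | h
    · rw [hε'def, min_eq_left h]; nlinarith
    · rw [hε'def, min_eq_right h.le]; nlinarith
  have hε'1 : ε' ≤ 1 / 15 := by
    have := min_le_right ε 1; rw [hε'def]; linarith
  obtain ⟨C, hC, hCP⟩ := hP ε' hε'0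
  -- exponent bookkeeping: `r := 2/3 − 4ε' ∈ [2/5, 2/3)`, `1/r ≤ 3/2 + ε`, constant `(5·max(C,1)⁴)³`
  set C₁ : ℝ := max C 1 ^ 4 with hC₁def
  have hC₁1 : 1 ≤ C₁ := one_le_pow₀ (le_max_right _ _)
  set r : ℝ := 2 / 3 - 4 * ε' with hrdef
  have hr0 : 2 / 5 ≤ r := by rw [hrdef]; linarith
  have hr1 : r ≤ 1 := by rw [hrdef]; linarith
  have hrε : 1 ≤ (3 / 2 + ε) * r := by rw [hrdef]; nlinarith
  refine ⟨(5 * C₁) ^ 3, by positivity, fun x d t hd ht hx => ?_⟩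
  -- `x ≥ 3`
  have hx3 : 3 ≤ x := by
    have h5 : 5 ≤ x ^ 2 := by
      rw [hx]; have := Nat.one_le_pow 4 t ht; nlinarith
    nlinarith
  have hX1 : (1 : ℝ) ≤ x := by exact_mod_cast (show 1 ≤ x by omega)
  have hX0 : (0 : ℝ) < x := by positivity
  have hD1 : (1 : ℝ) ≤ d := by exact_mod_cast hd
  -- `t ≤ C · x^(1/3 + ε')`
  have hdvd : t ^ 4 ∣ x ^ 2 - 1 := ⟨4 * d, by rw [hx, Nat.add_sub_cancel]; ring⟩
  have ht1 := hCP x t (by omega) hdvd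
  have ht0 : (0 : ℝ) ≤ t := Nat.cast_nonneg _
  -- `x² ≤ 5 C₁ d · x^(4/3 + 4ε')`
  have hs0 : (0 : ℝ) ≤ C * (x : ℝ) ^ ((1 : ℝ) / 3 + ε') := by positivity
  have ht4 : (t : ℝ) ^ 4 ≤ C₁ * (x : ℝ) ^ ((4 : ℝ) / 3 + 4 * ε') := by
    calc (t : ℝ) ^ 4 ≤ (C * (x : ℝ) ^ ((1 : ℝ) / 3 + ε')) ^ 4 := by gcongr
      _ = C ^ 4 * (x : ℝ) ^ ((4 : ℝ) / 3 + 4 * ε') := by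
          rw [mul_pow, ← Real.rpow_mul_natCast hX0.le]; congr 2; push_cast; ring
      _ ≤ C₁ * (x : ℝ) ^ ((4 : ℝ) / 3 + 4 * ε') := by
          rw [hC₁def]; gcongr; exact le_max_left _ _
  have hxr1 : (1 : ℝ) ≤ (x : ℝ) ^ ((4 : ℝ) / 3 + 4 * ε') := Real.one_le_rpow hX1 (by positivity)
  have hsq : (x : ℝ) ^ 2 ≤ 5 * C₁ * d * (x : ℝ) ^ ((4 : ℝ) / 3 + 4 * ε') := by
    have hxR : ((x : ℝ)) ^ 2 = 4 * d * (t : ℝ) ^ 4 + 1 := by exact_mod_cast hx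
    rw [hxR]
    have h4 : 4 * (d : ℝ) * (t : ℝ) ^ 4 ≤ 4 * d * (C₁ * (x : ℝ) ^ ((4 : ℝ) / 3 + 4 * ε')) := by gcongr
    nlinarith [mul_le_mul hD1 hxr1 zero_le_one (by positivity : (0:ℝ) ≤ d),
      mul_nonneg (by positivity : (0:ℝ) ≤ C₁ * d) (by positivity : (0:ℝ) ≤ (x:ℝ) ^ ((4:ℝ)/3 + 4*ε'))]
  -- hence `x^r ≤ 5 C₁ d`
  have hxr : (x : ℝ) ^ r ≤ 5 * C₁ * d := by
    have hsplit : (x : ℝ) ^ 2 = (x : ℝ) ^ r * (x : ℝ) ^ ((4 : ℝ) / 3 + 4 * ε') := by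
      rw [← Real.rpow_two, ← Real.rpow_add hX0]; congr 1; rw [hrdef]; ring
    rw [hsplit] at hsq
    have hpos : (0 : ℝ) < (x : ℝ) ^ ((4 : ℝ) / 3 + 4 * ε') := by positivity
    exact le_of_mul_le_mul_right hsq hpos
  -- contradiction if `x > (5 C₁)³ · d^(3/2 + ε)`
  by_contra hcon
  push Not at hcon
  have hK1 : (1 : ℝ) ≤ 5 * C₁ := by linarith
  have hbase0 : (0 : ℝ) ≤ (5 * C₁) ^ 3 * (d : ℝ) ^ ((3 : ℝ) / 2 + ε) := by positivity
  have h1 : ((5 * C₁) ^ 3 * (d : ℝ) ^ ((3 : ℝ) / 2 + ε)) ^ r < (x : ℝ) ^ r :=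
    Real.rpow_lt_rpow hbase0 hcon (by linarith)
  have h2 : 5 * C₁ * d ≤ ((5 * C₁) ^ 3 * (d : ℝ) ^ ((3 : ℝ) / 2 + ε)) ^ r := by
    rw [Real.mul_rpow (by positivity) (by positivity), ← Real.rpow_mul (by positivity),
      ← Real.rpow_natCast_mul (by positivity)]
    refine mul_le_mul ?_ ?_ (by positivity) (by positivity)
    · calc 5 * C₁ = (5 * C₁) ^ (1 : ℝ) := (Real.rpow_one _).symm
        _ ≤ (5 * C₁) ^ ((3 : ℕ) * r) := Real.rpow_le_rpow_of_exponent_le hK1 (by push_cast; linarith)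
    · calc (d : ℝ) = (d : ℝ) ^ (1 : ℝ) := (Real.rpow_one _).symm
        _ ≤ (d : ℝ) ^ (((3 : ℝ) / 2 + ε) * r) := Real.rpow_le_rpow_of_exponent_le hD1 hrε
  linarith [hxr, h1, h2]

end Summit.ABC.ABC.Theorems.UniformSadicTowerFour.FourthPowerDivisor
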